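import Mathlib
import Summits.MatrixMultiplication.MatrixMultiplication.Theses.LevelGradedCohnUmans

/-!
# `SnLevelDesigns` (stmt-MatrixMultiplication-7613), line `garnir-annihilator`:
# K4 `stub_hubTriples` — TRANSFER: a TPP triple of pattern classes in `S_k` gives a
# junta-separated triple in `S_{3m+k}` via three-alphabet hub gadgets

Crux `Summit.MatrixMultiplication.MatrixMultiplication.Theses.LevelGradedCohnUmans.SnLevelDesigns`;
skeleton `Cruxes/SnLevelDesigns/Lines/garnir_annihilator.lean` (registered stub K4);
this file proves the registered stub `stub_hubTriples` verbatim (name + signature, tree-only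
vocabulary) and lands `--supports stmt-MatrixMultiplication-7613`.

The construction (`n := 3m + k`). The points of `Fin n` split into four blocks (`ht_letters`): the
A-letters `a ↦ a`, the B-letters `b ↦ m + b`, the C-letters `c ↦ 2m + c` (all indexed by `Fin m`) and
the `k` hubs `hub i = 3m + i`; the four blocks are pairwise disjoint. For an injective word
`c : Fin k → Fin n` avoiding the hubs, the hub gadget of `c` is the involution swapping `hub i ↔ c i`
for every `i` and fixing everything else (built with `Function.Involutive.toPerm`). For a letter
block `E ∈ {A, B, C}`, a `k`-subset `S` of `Fin m` with increasing enumeration `e_S`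
(`Finset.orderEmbOfFin`) and a pattern `α ∈ S_k` we use the gadget `F_E (S, α) := gad (E ∘ e_S ∘ α)`
(`ht_family_exists`); the gadget recovers the word `E ∘ e_S ∘ α` as the images of the hubs, hence `S`
(`ht_sel_eq`) and then `α`, so `(S, α) ↦ F_E (S, α)` is injective. Put `X := F_A (k-subsets × P₁)`,
`Y := F_C (k-subsets × P₂)`, `Z := F_B (k-subsets × P₃)`; the cards are `C(m,k)·|Pᵢ|`
(`ht_card_univ_prod`).

Junta. For the target `(x₀, z₀) = (F_A (S₀, α₀), F_B (U₀, β₀))` take the frame `ι i := B (e_{U₀} (β₀ i))`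
(the B-letters of `z₀` in index order). The target values are `x₀ (z₀ (ι i)) = x₀ (hub i) = A (e_{S₀} (α₀ i))`,
all A-letters. For garbage `(x, y, y', z) = (F_A (S,α), F_C (V,γ), F_C (V',γ'), F_B (U,β))` (all gadgets are
involutions) the value `x (y (y' (z (ι i))))` is computed inside out: `z` sends `ι i` to `hub j` when
`e_U (β j) = e_{U₀} (β₀ i)` and fixes it otherwise (then it stays a B-letter to the end: no agreement);
`y'` sends `hub j ↦ C (e_{V'} (γ' j))`; `y` sends this C-letter to `hub l` when
`e_V (γ l) = e_{V'} (γ' j)` and fixes it otherwise (then it stays a C-letter: no agreement); finally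
`x (hub l) = A (e_S (α l))`. So agreement on the frame forces, for every `i`, indices `J i`, `L i` with
`e_U (β (J i)) = e_{U₀} (β₀ i)`, `e_V (γ (L i)) = e_{V'} (γ' (J i))`, `e_S (α (L i)) = e_{S₀} (α₀ i)`.
By `ht_sel_eq` (a `k`-subset containing the image of a `k`-subset under a permuted enumeration equals it)
`U = U₀`, `S = S₀`, `V = V'`, and then `β (J i) = β₀ i`, `α (L i) = α₀ i`, `γ (L i) = γ' (J i)`, which
reads `α₀⁻¹ α (γ⁻¹ γ') (β⁻¹ β₀) = 1` in `S_k`. The TPP hypothesis gives `α₀ = α`, `γ = γ'`, `β = β₀`: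
the garbage quadruple is the excluded one.

Proof uses Mathlib only (`Function.Involutive.toPerm`, `Equiv.Perm.inv_def`, `Equiv.Perm.mul_apply`,
`Equiv.Perm.inv_eq_iff_eq`, `Finset.orderEmbOfFin`, `Finset.range_orderEmbOfFin`,
`Finset.eq_of_subset_of_card_le`, `Fintype.card_of_subtype`, `Finset.card_powersetCard`,
`Finset.card_product`, `Finset.card_image_of_injective`); no new definitions (the gadget families are
packaged as existence statements and chosen with `choose` / `obtain`). The gadget and the letter
blocks are adapted from the two-set file `Theorems/LevelGradedCohnUmansSnLevelDesignsStubHubPairs.lean`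
(`hp_gad_exists`, `hp_letters`; renamed and repackaged, not imported).
-/

-- the problem path repeats `MatrixMultiplication` (summit = problem), as in every file of this line
set_option linter.dupNamespace false

namespace Summit.MatrixMultiplication.MatrixMultiplication.Theorems.SnLevelDesigns

open Function

/-- The hub-gadget family of a letter block. Given the hubs `hub : Fin k ↪ Fin n` and a block of
letters `E : Fin m ↪ Fin n` avoiding the hubs, there is a family `F` of permutations of `Fin n`
indexed by the pairs `(S, α)` (`S` a `k`-subset of `Fin m`, `α ∈ S_k`) such that `F (S, α)` is its
own inverse, swaps `hub i ↔ E (e_S (α i))` for every `i` (`e_S` the increasing enumeration of `S`),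
and fixes every point that is neither a hub nor one of these `k` letters: `F (S, α)` is the product
of the `k` disjoint transpositions `(hub i, E (e_S (α i)))`. -/
-- the inner gadget `gad_exists` is adapted from `hp_gad_exists`
-- (Theorems/LevelGradedCohnUmansSnLevelDesignsStubHubPairs.lean)
theorem ht_family_exists {m n k : ℕ} (hub : Fin k ↪ Fin n) (E : Fin m ↪ Fin n)
    (hE : ∀ a i, E a ≠ hub i) :
    ∃ F : {S : Finset (Fin m) // S.card = k} × Equiv.Perm (Fin k) → Equiv.Perm (Fin n),
      (∀ p, (F p)⁻¹ = F p) ∧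
      (∀ (S : Finset (Fin m)) (hS : S.card = k) (α : Equiv.Perm (Fin k)) (i : Fin k),
          F (⟨S, hS⟩, α) (hub i) = E (S.orderEmbOfFin hS (α i))) ∧
      (∀ (S : Finset (Fin m)) (hS : S.card = k) (α : Equiv.Perm (Fin k)) (i : Fin k),
          F (⟨S, hS⟩, α) (E (S.orderEmbOfFin hS (α i))) = hub i) ∧
      (∀ (S : Finset (Fin m)) (hS : S.card = k) (α : Equiv.Perm (Fin k)) (p : Fin n),
          (∀ i, hub i ≠ p) → (∀ i, E (S.orderEmbOfFin hS (α i)) ≠ p) → F (⟨S, hS⟩, α) p = p) := by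
  classical
  -- the hub gadget of an injective hub-free word `c`: the involution `hub i ↔ c i`
  have gad_exists : ∀ c : Fin k → Fin n, Injective c → (∀ i j, c i ≠ hub j) →
      ∃ σ : Equiv.Perm (Fin n), σ⁻¹ = σ ∧ (∀ i, σ (hub i) = c i) ∧ (∀ i, σ (c i) = hub i) ∧
        ∀ p, (∀ i, hub i ≠ p) → (∀ i, c i ≠ p) → σ p = p := by
    intro c hc hch
    obtain ⟨f, hf⟩ : ∃ f : Fin n → Fin n, ∀ p, f p =
        if h : ∃ i, hub i = p then c (Classical.choose h)
        else if h' : ∃ i, c i = p then hub (Classical.choose h') else p := ⟨_, fun _ => rfl⟩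
    have hf_hub : ∀ i, f (hub i) = c i := by
      intro i
      have h : ∃ j, hub j = hub i := ⟨i, rfl⟩
      rw [hf, dif_pos h]
      exact congrArg c (hub.injective (Classical.choose_spec h))
    have hf_val : ∀ i, f (c i) = hub i := by
      intro i
      have h : ¬ ∃ j, hub j = c i := fun ⟨j, hj⟩ => hch i j hj.symm
      have h' : ∃ j, c j = c i := ⟨i, rfl⟩
      rw [hf, dif_neg h, dif_pos h']
      congr 1
      exact hc (Classical.choose_spec h')
    have hf_fix : ∀ p, (∀ i, hub i ≠ p) → (∀ i, c i ≠ p) → f p = p := by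
      intro p h1 h2
      have h : ¬ ∃ j, hub j = p := fun ⟨j, hj⟩ => h1 j hj
      have h' : ¬ ∃ j, c j = p := fun ⟨j, hj⟩ => h2 j hj
      rw [hf, dif_neg h, dif_neg h']
    have hfi : Involutive f := by
      intro p
      by_cases h : ∃ i, hub i = p
      · obtain ⟨i, rfl⟩ := h
        rw [hf_hub, hf_val]
      · by_cases h' : ∃ i, c i = p
        · obtain ⟨i, rfl⟩ := h'
          rw [hf_val, hf_hub]
        · rw [hf_fix p (fun i hi => h ⟨i, hi⟩) (fun i hi => h' ⟨i, hi⟩),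
            hf_fix p (fun i hi => h ⟨i, hi⟩) (fun i hi => h' ⟨i, hi⟩)]
    refine ⟨Function.Involutive.toPerm f hfi, ?_, hf_hub, hf_val, hf_fix⟩
    rw [Equiv.Perm.inv_def]
    exact Function.Involutive.toPerm_symm _
  choose gad hinv hhub hval hfix using gad_exists
  -- the words `E ∘ e_S ∘ α` are injective and hub-free
  have hW : ∀ (S : Finset (Fin m)) (hS : S.card = k) (α : Equiv.Perm (Fin k)),
      Injective (fun i => E (S.orderEmbOfFin hS (α i))) :=
    fun S hS α => E.injective.comp ((S.orderEmbOfFin hS).injective.comp α.injective)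
  have hWh : ∀ (S : Finset (Fin m)) (hS : S.card = k) (α : Equiv.Perm (Fin k)) (i j : Fin k),
      (fun i => E (S.orderEmbOfFin hS (α i))) i ≠ hub j :=
    fun S hS α i j => hE _ _
  refine ⟨fun p => gad _ (hW p.1.1 p.1.2 p.2) (hWh p.1.1 p.1.2 p.2), ?_, ?_, ?_, ?_⟩
  · rintro ⟨⟨S, hS⟩, α⟩
    exact hinv _ _ _
  · intro S hS α i
    exact hhub _ _ _ i
  · intro S hS α i
    exact hval _ _ _ i
  · intro S hS α p h1 h2
    exact hfix _ _ _ p h1 h2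

/-- The four blocks of `Fin (3m + k)`: the A-letters `a ↦ a`, the B-letters `b ↦ m + b`, the
C-letters `c ↦ 2m + c` (all indexed by `Fin m`) and the hubs `i ↦ 3m + i` (indexed by `Fin k`),
four embeddings with pairwise disjoint ranges. -/
-- adapted from `hp_letters` (Theorems/LevelGradedCohnUmansSnLevelDesignsStubHubPairs.lean)
theorem ht_letters (m k : ℕ) :
    ∃ (A B C : Fin m ↪ Fin (3 * m + k)) (hub : Fin k ↪ Fin (3 * m + k)),
      (∀ a b, A a ≠ B b) ∧ (∀ a c, A a ≠ C c) ∧ (∀ b c, B b ≠ C c) ∧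
        (∀ a i, A a ≠ hub i) ∧ (∀ b i, B b ≠ hub i) ∧ (∀ c i, C c ≠ hub i) := by
  refine ⟨⟨fun a => ⟨(a : ℕ), by have := a.isLt; omega⟩,
      fun a a' h => Fin.ext (Fin.mk.inj h)⟩,
    ⟨fun b => ⟨m + (b : ℕ), by have := b.isLt; omega⟩,
      fun b b' h => Fin.ext (by have := Fin.mk.inj h; omega)⟩,
    ⟨fun c => ⟨2 * m + (c : ℕ), by have := c.isLt; omega⟩,
      fun c c' h => Fin.ext (by have := Fin.mk.inj h; omega)⟩,
    ⟨fun i => ⟨3 * m + (i : ℕ), by have := i.isLt; omega⟩,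
      fun i i' h => Fin.ext (by have := Fin.mk.inj h; omega)⟩, ?_, ?_, ?_, ?_, ?_, ?_⟩
  all_goals
    intro a b h
    have h' := Fin.mk.inj h
    have := a.isLt
    omega

/-- The index set `(k-subsets of Fin m) × P` of a gadget family restricted to a pattern class
`P ⊆ S_k` has `C(m,k)·|P|` elements. -/
theorem ht_card_univ_prod (m k : ℕ) (P : Finset (Equiv.Perm (Fin k))) :
    ((Finset.univ : Finset {S : Finset (Fin m) // S.card = k}) ×ˢ P).card = m.choose k * P.card := by
  have H : ∀ S : Finset (Fin m),
      S ∈ Finset.powersetCard k (Finset.univ : Finset (Fin m)) ↔ S.card = k :=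
    fun S => Finset.mem_powersetCard_univ
  rw [Finset.card_product, Finset.card_univ, Fintype.card_of_subtype _ H, Finset.card_powersetCard,
    Finset.card_univ, Fintype.card_fin]

/-- Selection recovery. If two `k`-subsets `S`, `T` of `Fin m` satisfy `e_S (f i) = e_T (g i)` for
all `i : Fin k`, where `e_S`, `e_T` are the increasing enumerations, `f` is any self-map of `Fin k`
and `g` is a permutation of `Fin k`, then `S = T` (indeed `T ⊆ S`, and the cards agree). -/
theorem ht_sel_eq {m k : ℕ} {S T : Finset (Fin m)} (hS : S.card = k) (hT : T.card = k)
    (f : Fin k → Fin k) (g : Equiv.Perm (Fin k))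
    (h : ∀ i, S.orderEmbOfFin hS (f i) = T.orderEmbOfFin hT (g i)) : S = T := by
  symm
  refine Finset.eq_of_subset_of_card_le (fun t ht => ?_) (by rw [hS, hT])
  have ht' : t ∈ Set.range (T.orderEmbOfFin hT) := by
    rw [Finset.range_orderEmbOfFin]
    exact ht
  obtain ⟨i, rfl⟩ := ht'
  have hi := h (g.symm i)
  rw [Equiv.apply_symm_apply] at hi
  rw [← hi]
  exact Finset.orderEmbOfFin_mem S hS _

/-- **`stub_hubTriples`** (registered stub K4 of crux stmt-MatrixMultiplication-7613, line
`garnir-annihilator`; TRANSFER). Every triple `(P₁, P₂, P₃)` of pattern classes in `S_k` with the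
triple product property `α⁻¹ α' (γ⁻¹ γ') (β⁻¹ β') = 1 ⇒ α = α', γ = γ', β = β'` transfers to sets
`X, Y, Z ⊆ S_{3m+k}` with `|X| = C(m,k)|P₁|`, `|Y| = C(m,k)|P₂|`, `|Z| = C(m,k)|P₃|` such that every
target `x₀⁻¹ z₀` is told apart from every garbage product `x⁻¹ y y'⁻¹ z` (`(x, y, z) ≠ (x₀, y', z₀)`)
by its restriction to a frame `ι : Fin k → Fin (3m+k)` depending on the target. Construction:
`X`, `Y`, `Z` = hub gadgets of the words `A ∘ e_S ∘ α` (`α ∈ P₁`), `C ∘ e_V ∘ γ` (`γ ∈ P₂`),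
`B ∘ e_U ∘ β` (`β ∈ P₃`) over the `k`-subsets `S, V, U` of `Fin m`; frame of the target = the
B-letters of `z₀` in index order; see the module docstring for the junta argument. -/
theorem stub_hubTriples :
    ∀ (m k : ℕ) (P₁ P₂ P₃ : Finset (Equiv.Perm (Fin k))),
      (∀ α ∈ P₁, ∀ α' ∈ P₁, ∀ γ ∈ P₂, ∀ γ' ∈ P₂, ∀ β ∈ P₃, ∀ β' ∈ P₃,
          α⁻¹ * α' * (γ⁻¹ * γ') * (β⁻¹ * β') = 1 → α = α' ∧ γ = γ' ∧ β = β') →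
      ∃ X Y Z : Finset (Equiv.Perm (Fin (3 * m + k))),
        X.card = m.choose k * P₁.card ∧ Y.card = m.choose k * P₂.card ∧ Z.card = m.choose k * P₃.card ∧
          ∀ x₀ ∈ X, ∀ z₀ ∈ Z, ∃ ι : Fin k → Fin (3 * m + k), ∀ x ∈ X, ∀ y ∈ Y, ∀ y' ∈ Y, ∀ z ∈ Z,
            ¬ (x = x₀ ∧ y = y' ∧ z = z₀) → (⇑(x⁻¹ * y * y'⁻¹ * z)) ∘ ι ≠ (⇑(x₀⁻¹ * z₀)) ∘ ι := by
  intro m k P₁ P₂ P₃ hTPP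
  obtain ⟨A, B, C, hub, hAB, hAC, hBC, hAhub, hBhub, hChub⟩ := ht_letters m k
  -- the gadget family `F E hE` of each hub-free letter block `E`, with its evaluation rules
  have hfam := fun (E : Fin m ↪ Fin (3 * m + k)) (hE : ∀ a i, E a ≠ hub i) =>
    ht_family_exists hub E hE
  choose F hFinv hFhub hFval hFfix using hfam
  have hFfixE : ∀ (E : Fin m ↪ Fin (3 * m + k)) (hE : ∀ a i, E a ≠ hub i)
      (q : {S : Finset (Fin m) // S.card = k} × Equiv.Perm (Fin k)) (p : Fin (3 * m + k)),
      (∀ i, hub i ≠ p) → (∀ a, E a ≠ p) → F E hE q p = p := by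
    rintro E hE ⟨⟨S, hS⟩, α⟩ p h1 h2
    exact hFfix E hE S hS α p h1 (fun i => h2 _)
  -- the gadget of `(S, α)` recovers `(S, α)` as the images of the hubs
  have hFinj : ∀ (E : Fin m ↪ Fin (3 * m + k)) (hE : ∀ a i, E a ≠ hub i), Injective (F E hE) := by
    rintro E hE ⟨⟨S, hS⟩, α⟩ ⟨⟨T, hT⟩, α'⟩ h
    have h' : ∀ i, S.orderEmbOfFin hS (α i) = T.orderEmbOfFin hT (α' i) := by
      intro i
      have hi := Equiv.congr_fun h (hub i)
      rw [hFhub, hFhub] at hi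
      exact E.injective hi
    have hST : S = T := ht_sel_eq hS hT (fun i => α i) α' h'
    subst hST
    have hαα : α = α' := Equiv.ext fun i => (Finset.orderEmbOfFin _ _).injective (h' i)
    subst hαα
    rfl
  have hcard : ∀ (E : Fin m ↪ Fin (3 * m + k)) (hE : ∀ a i, E a ≠ hub i)
      (P : Finset (Equiv.Perm (Fin k))),
      ((Finset.univ ×ˢ P).image (F E hE)).card = m.choose k * P.card := by
    intro E hE P
    rw [Finset.card_image_of_injective _ (hFinj E hE), ht_card_univ_prod]
  refine ⟨(Finset.univ ×ˢ P₁).image (F A hAhub), (Finset.univ ×ˢ P₂).image (F C hChub),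
    (Finset.univ ×ˢ P₃).image (F B hBhub), hcard _ _ _, hcard _ _ _, hcard _ _ _, ?_⟩
  -- the junta: the frame of the target `(F_A (S₀, α₀), F_B (U₀, β₀))` is `B ∘ e_{U₀} ∘ β₀`
  intro x₀ hx₀ z₀ hz₀
  obtain ⟨⟨⟨S₀, hS₀⟩, α₀⟩, hx₀', rfl⟩ := Finset.mem_image.1 hx₀
  obtain ⟨⟨⟨U₀, hU₀⟩, β₀⟩, hz₀', rfl⟩ := Finset.mem_image.1 hz₀
  have hα₀ : α₀ ∈ P₁ := (Finset.mem_product.1 hx₀').2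
  have hβ₀ : β₀ ∈ P₃ := (Finset.mem_product.1 hz₀').2
  refine ⟨fun i => B (U₀.orderEmbOfFin hU₀ (β₀ i)), ?_⟩
  intro x hx y hy y' hy' z hz hne H
  obtain ⟨⟨⟨S, hS⟩, α⟩, hx', rfl⟩ := Finset.mem_image.1 hx
  obtain ⟨⟨⟨V, hV⟩, γ⟩, hy'', rfl⟩ := Finset.mem_image.1 hy
  obtain ⟨⟨⟨V', hV'⟩, γ'⟩, hy''', rfl⟩ := Finset.mem_image.1 hy'
  obtain ⟨⟨⟨U, hU⟩, β⟩, hz', rfl⟩ := Finset.mem_image.1 hz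
  have hα : α ∈ P₁ := (Finset.mem_product.1 hx').2
  have hγ : γ ∈ P₂ := (Finset.mem_product.1 hy'').2
  have hγ' : γ' ∈ P₂ := (Finset.mem_product.1 hy''').2
  have hβ : β ∈ P₃ := (Finset.mem_product.1 hz').2
  apply hne
  -- Step 1: every frame value of the target forces a chain `ι i ↦ hub j ↦ C-letter ↦ hub l ↦ A-letter`.
  have key : ∀ i, ∃ j l, U.orderEmbOfFin hU (β j) = U₀.orderEmbOfFin hU₀ (β₀ i) ∧
      V.orderEmbOfFin hV (γ l) = V'.orderEmbOfFin hV' (γ' j) ∧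
      S.orderEmbOfFin hS (α l) = S₀.orderEmbOfFin hS₀ (α₀ i) := by
    intro i
    have Hi := congrFun H i
    simp only [Function.comp_apply, Equiv.Perm.mul_apply, hFinv] at Hi
    rw [hFval B hBhub U₀ hU₀ β₀ i, hFhub A hAhub S₀ hS₀ α₀ i] at Hi
    by_cases hj : ∃ j, U.orderEmbOfFin hU (β j) = U₀.orderEmbOfFin hU₀ (β₀ i)
    · obtain ⟨j, hj⟩ := hj
      rw [← hj, hFval B hBhub U hU β j, hFhub C hChub V' hV' γ' j] at Hi
      by_cases hl : ∃ l, V.orderEmbOfFin hV (γ l) = V'.orderEmbOfFin hV' (γ' j)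
      · obtain ⟨l, hl⟩ := hl
        rw [← hl, hFval C hChub V hV γ l, hFhub A hAhub S hS α l] at Hi
        exact ⟨j, l, hj, hl, A.injective Hi⟩
      · exfalso
        rw [hFfix C hChub V hV γ _ (fun i => (hChub _ _).symm) (fun l h => hl ⟨l, C.injective h⟩),
          hFfixE A hAhub _ _ (fun i => (hChub _ _).symm) (fun a => hAC a _)] at Hi
        exact hAC _ _ Hi.symm
    · exfalso
      rw [hFfix B hBhub U hU β _ (fun i => (hBhub _ _).symm) (fun j h => hj ⟨j, B.injective h⟩),
        hFfixE C hChub _ _ (fun i => (hBhub _ _).symm) (fun c => (hBC _ c).symm),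
        hFfixE C hChub _ _ (fun i => (hBhub _ _).symm) (fun c => (hBC _ c).symm),
        hFfixE A hAhub _ _ (fun i => (hBhub _ _).symm) (fun a => hAB a _)] at Hi
      exact hAB _ _ Hi.symm
  choose J L hJ hL hA using key
  -- Step 2: the selections agree (`U = U₀`, `S = S₀`, `V = V'`) and the patterns satisfy
  -- `β ∘ J = β₀`, `α ∘ L = α₀`, `γ ∘ L = γ' ∘ J`.
  have hUU : U = U₀ := ht_sel_eq hU hU₀ (fun i => β (J i)) β₀ hJ
  subst hUU
  have hb : ∀ i, β (J i) = β₀ i := fun i => (Finset.orderEmbOfFin _ _).injective (hJ i)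
  have hSS : S = S₀ := ht_sel_eq hS hS₀ (fun i => α (L i)) α₀ hA
  subst hSS
  have ha : ∀ i, α (L i) = α₀ i := fun i => (Finset.orderEmbOfFin _ _).injective (hA i)
  have hJ' : ∀ i, β⁻¹ (β₀ i) = J i := fun i => Equiv.Perm.inv_eq_iff_eq.mpr (hb i).symm
  have hVV : V = V' := ht_sel_eq hV hV' (fun i => γ (L i)) (γ' * β⁻¹ * β₀) (fun i => by
    rw [Equiv.Perm.mul_apply, Equiv.Perm.mul_apply, hJ' i]
    exact hL i)
  subst hVV
  have hc : ∀ i, γ (L i) = γ' (J i) := fun i => (Finset.orderEmbOfFin _ _).injective (hL i)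
  -- Step 3: the relation `α₀⁻¹ α (γ⁻¹ γ') (β⁻¹ β₀) = 1` in `S_k`, and the TPP hypothesis.
  have hrel : α₀⁻¹ * α * (γ⁻¹ * γ') * (β⁻¹ * β₀) = 1 := by
    refine Equiv.ext fun i => ?_
    have h2 : γ⁻¹ (γ' (J i)) = L i := Equiv.Perm.inv_eq_iff_eq.mpr (hc i).symm
    have h3 : α₀⁻¹ (α (L i)) = i := Equiv.Perm.inv_eq_iff_eq.mpr (ha i)
    simp only [Equiv.Perm.mul_apply, Equiv.Perm.one_apply]
    rw [hJ' i, h2, h3]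
  obtain ⟨rfl, rfl, rfl⟩ := hTPP α₀ hα₀ α hα γ hγ γ' hγ' β hβ β₀ hβ₀ hrel
  exact ⟨rfl, rfl, rfl⟩

end Summit.MatrixMultiplication.MatrixMultiplication.Theorems.SnLevelDesigns
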